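import Summits.SmoothPoincare4.SmoothPoincare4.Theorems.CongruenceShadowsShadowApproximationStubLayerStepOneZeroAssembly
import HarnessLib

/-!
# Helper for stub `stub_layerStepTwoZero` (line `nilpotent-genus-class`, crux
`CongruenceShadows.ShadowApproximation`, item stmt-SmoothPoincare4-14595):
# slot-keeping pair normalisation, vanishing readings, and uniqueness of readings at genus `3 + 3m`

`S = SurfaceGroup (3+3m)`, `N i = s4Kernels.stabilizeIter m i`, `γₖ₊₁ = (⊤).lowerCentralSeries k`, `Cᵢ = s4CutSystem m i`,
`π : S ↠ F = FreeGroup (Fin (3+3m))` the erasing projection of the cut pattern `ct` of slot `2` (`ker π = N₂`); an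
IA-automorphism `ψ` READS AS the integer form `D` when `π(ψ(x_j) x_j⁻¹) ≡ ∏_{v<w} [y_v, y_w] ^ (s_j D j v w)` modulo `γ₃ F`
for every slot-`2` cut letter `x_j` (`s_j = -1` on `b`-cut handles), as in the landed `reading_ia_g`.
For `m ≥ 2` the degree-`1` gate is not vacuous: the Johnson datum of an honest kernel `K₂` avoids the monomials without
`C₀`-letters and those without `C₁`-letters (at genus `9`: `b₁b₄b₇` and `b₂b₅b₈`; W6's evidence `evidence-layer01.md` §5.5
on the item).  This file supplies the three genus-general facts behind that:

* `exists_ia_stab_of_pair_stabilizeIter` — **pair normalisation keeping the slot**: granted (AUTSYMP) at genus `3+3m`,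
  an `α ∈ Stab Nᵢ` (`i ≠ 2`) with `α(N₂) = P`, `P γ₂ = N₂ γ₂` is replaced by an IA-automorphism `α' ∈ Stab Nᵢ` with
  `α'(N₂) = P` (the landed `exists_ia_of_pair_stabilizeIter` does not record `α' ∈ Stab Nᵢ`; same proof: the
  coordinate-pair Goeritz realisation `exists_goeritz_realises` for the pair `(i, 2)`).
* `reading_eq_zero_of_map_stabilizeIter_eq` — **vanishing readings**: if `ψ ∈ Stab Nᵢ` is IA and reads as `D`, then
  `D j v w = 0` (`v < w`) whenever the slot-`2` cut letters of the handles `j, v, w` are `Cᵢ`-letters: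
  `ψ(x_j)x_j⁻¹ ∈ Nᵢ ∩ γ₂ = [Nᵢ, S]` (no hidden depth), whose image under `π` dies under the endomorphism `ρ` of `F`
  killing the generators `h` whose `Cᵢ`-letter survives `π`; `ρ` fixes `[y_v, y_w]`, and Magnus–Witt independence
  (`stub_magnusWittRead.1`) gives `D j v w = 0`.
* `forms_eq_of_map_eq` — **uniqueness of readings**: two IA-automorphisms with `ψ(N₂) = φ(N₂)` read equally on
  `v < w` (torsor calculus `level_mem_iff` over the honest kernel `φ(N₂)`, then `π`, then Magnus–Witt independence) —
  the converse of the landed `map_sup_eq_of_forms_g`.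
No definitions.
-/

set_option linter.dupNamespace false

noncomputable section

open Subgroup Literature.Topology.FourManifolds Literature.Algebra.Lie Multiplicative
open Summit.SmoothPoincare4.SmoothPoincare4.Theorems.NilpotentShadowsStandard.SaturatedTorsorDescent
open scoped commutatorElement

namespace Summit.SmoothPoincare4.SmoothPoincare4.Theorems.ShadowApproximation.NilpotentGenusClass

variable {m : ℕ}

/-! ## §1 Pair normalisation keeping the slot -/

section PairNormalisation

/-- **Pair normalisation keeping the slot**, genus `3 + 3m`.  Granted (AUTSYMP) at genus `3+3m`: if `α ∈ Stab Nᵢ`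
(`i ≠ 2`) carries `N₂` onto `P` and `P γ₂ = N₂ γ₂`, then some IA-automorphism `α' ∈ Stab Nᵢ` carries `N₂` onto `P`
(`α' = α ∘ x⁻¹` for a realiser `x ∈ Stab Nᵢ ∩ Stab N₂` of `ᾱ`). [folklore] -/
theorem exists_ia_stab_of_pair_stabilizeIter
    (hA : (∀ (φ : (SurfaceGroup (3 + 3 * m)) ≃* (SurfaceGroup (3 + 3 * m))), ∃ (F : (surfaceGen (3 + 3 * m) → ℤ) ≃ₗ[ℤ] (surfaceGen (3 + 3 * m) → ℤ)) (ε : ℤ),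
      (ε = 1 ∨ ε = -1) ∧ (∀ s : (SurfaceGroup (3 + 3 * m)), toAdd (SurfaceGroup.abelianize (3 + 3 * m) (φ s)) =
        F (toAdd (SurfaceGroup.abelianize (3 + 3 * m) s))) ∧
        ∀ u v : surfaceGen (3 + 3 * m) → ℤ, symplForm (F u) (F v) = ε * symplForm u v))
    {i : Fin 3} (hi : i ≠ 2) {P : Subgroup (SurfaceGroup (3 + 3 * m))} {α : (SurfaceGroup (3 + 3 * m)) ≃* (SurfaceGroup (3 + 3 * m))}
    (hαi : (s4Kernels.stabilizeIter m i).map α.toMonoidHom = s4Kernels.stabilizeIter m i)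
    (hα2 : (s4Kernels.stabilizeIter m 2).map α.toMonoidHom = P)
    (hP : P ⊔ ((⊤ : Subgroup (SurfaceGroup (3 + 3 * m))).lowerCentralSeries 1) = s4Kernels.stabilizeIter m 2 ⊔ ((⊤ : Subgroup (SurfaceGroup (3 + 3 * m))).lowerCentralSeries 1)) :
    ∃ α' : (SurfaceGroup (3 + 3 * m)) ≃* (SurfaceGroup (3 + 3 * m)), (∀ s, α' s * s⁻¹ ∈ ((⊤ : Subgroup (SurfaceGroup (3 + 3 * m))).lowerCentralSeries 1)) ∧
      (s4Kernels.stabilizeIter m i).map α'.toMonoidHom = s4Kernels.stabilizeIter m i ∧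
      (s4Kernels.stabilizeIter m 2).map α'.toMonoidHom = P := by
  -- adapted from the landed `exists_ia_of_pair_stabilizeIter` (slot `0`)
  obtain ⟨F, ε, hε, hF, hiso⟩ := hA α
  have hΛi := map_Λ_stabilizeIter_of_map_eq α F hF hαi
  have hΛ2 := map_Λ_stabilizeIter_of_map_sup_eq α F hF hα2 hP
  rw [span_single_s4CutSystem] at hΛi hΛ2
  have hi' : (i : ℕ) ≠ 2 := fun h => hi (Fin.ext (by rw [h]; rfl))
  have hi2 : ∀ j : Fin (3 + 3 * m), decide (((j : ℕ) + ((i : Fin 3) : ℕ)) % 3 = 2) = true →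
      decide (((j : ℕ) + ((2 : Fin 3) : ℕ)) % 3 = 2) = false := by
    intro j
    simp only [Fin.val_two, decide_eq_true_eq, decide_eq_false_iff_not]
    have := i.isLt
    omega
  obtain ⟨x, hxi, hx2, hx⟩ := exists_goeritz_realises _ _ hi2 F ε hε hiso
    (coords_of_map_span_eq _ F hΛi) (coords_of_map_span_eq _ F hΛ2)
  rw [← stabilizeIter_eq_cutKernel] at hxi hx2
  have hab_symm : ∀ s, toAdd (SurfaceGroup.abelianize (3 + 3 * m) (x.symm s)) =
      F.symm (toAdd (SurfaceGroup.abelianize (3 + 3 * m) s)) := fun s => by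
    rw [eq_comm, LinearEquiv.symm_apply_eq, ← hx, MulEquiv.apply_symm_apply]
  refine ⟨x.symm.trans α, fun s => mul_inv_mem_lcs_one_of_ab_eq ?_, ?_, ?_⟩
  · rw [MulEquiv.trans_apply, hF, hab_symm, LinearEquiv.apply_symm_apply]
  · rw [map_trans, map_symm_of_map x hxi, hαi]
  · rw [map_trans, map_symm_of_map x hx2, hα2]

end PairNormalisation

/-! ## §2 Vanishing readings of slot stabilisers -/

section Vanishing

variable {ct : Fin (3 + 3 * m) → Bool} {π : (SurfaceGroup (3 + 3 * m)) →* (FreeGroup (Fin (3 + 3 * m)))}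

/-- Pair products whose letters outside `T` are killed: only the pairs inside `T` survive. [folklore] -/
theorem pp_kill (T : Fin (3 + 3 * m) → Prop) [DecidablePred T] (e : Fin (3 + 3 * m) → Fin (3 + 3 * m) → ℤ) :
    (((List.finRange (3 + 3 * m)).map (fun v => ((List.finRange (3 + 3 * m)).map (fun w => if v < w then ⁅(if T v then (FreeGroup.of v : (FreeGroup (Fin (3 + 3 * m)))) else 1), (if T w then (FreeGroup.of w : (FreeGroup (Fin (3 + 3 * m)))) else 1)⁆ ^ (e v w) else (1 : (FreeGroup (Fin (3 + 3 * m)))))).prod)).prod) =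
    (((List.finRange (3 + 3 * m)).map (fun v => ((List.finRange (3 + 3 * m)).map (fun w => if v < w then ⁅(FreeGroup.of v : FreeGroup (Fin (3 + 3 * m))), FreeGroup.of w⁆ ^ (if T v ∧ T w then e v w else 0) else (1 : (FreeGroup (Fin (3 + 3 * m)))))).prod)).prod) := by
  refine pp_congr _ _ _ _ fun v w _ => ?_
  by_cases hv : T v
  · by_cases hw : T w
    · rw [if_pos hv, if_pos hw, if_pos ⟨hv, hw⟩]
    · rw [if_pos hv, if_neg hw, commutatorElement_one_right, one_zpow, if_neg (not_and_of_not_right _ hw), zpow_zero]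
  · rw [if_neg hv, commutatorElement_one_left, one_zpow, if_neg (not_and_of_not_left _ hv), zpow_zero]

/-- **Vanishing readings of slot stabilisers.**  If `ψ ∈ Stab Nᵢ` is IA and reads (through the erasing projection
`π` of the slot-`2` pattern `ct`) as `D`, then `D j v w = 0` for `v < w` whenever the slot-`2` cut letters
`(h, ct h)` of the three handles `h = j, v, w` are `Cᵢ`-letters. [folklore] -/
theorem reading_eq_zero_of_map_stabilizeIter_eq (hπs : Function.Surjective π)
    (hπof : ∀ (h : Fin (3 + 3 * m)) (c : Bool), π (PresentedGroup.of (h, c)) = if c = ct h then 1 else FreeGroup.of h)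
    (i : Fin 3) (ψ : (SurfaceGroup (3 + 3 * m)) ≃* (SurfaceGroup (3 + 3 * m))) (hψ : ∀ s : (SurfaceGroup (3 + 3 * m)), ψ s * s⁻¹ ∈ ((⊤ : Subgroup (SurfaceGroup (3 + 3 * m))).lowerCentralSeries 1))
    (hψi : (s4Kernels.stabilizeIter m i).map ψ.toMonoidHom = s4Kernels.stabilizeIter m i)
    (D : Fin (3 + 3 * m) → Fin (3 + 3 * m) → Fin (3 + 3 * m) → ℤ)
    (hD : (∀ j : Fin (3 + 3 * m), π (ψ (PresentedGroup.of (j, ct j)) * (PresentedGroup.of (j, ct j))⁻¹) *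
        (((List.finRange (3 + 3 * m)).map (fun v => ((List.finRange (3 + 3 * m)).map (fun w => if v < w then ⁅(FreeGroup.of v : FreeGroup (Fin (3 + 3 * m))), FreeGroup.of w⁆ ^ ((if ct j then (-1 : ℤ) else 1) * D j v w) else (1 : (FreeGroup (Fin (3 + 3 * m)))))).prod)).prod)⁻¹ ∈ ((⊤ : Subgroup (FreeGroup (Fin (3 + 3 * m)))).lowerCentralSeries 2)))
    (j v w : Fin (3 + 3 * m)) (hvw : v < w) (hj : (j, ct j) ∈ s4CutSystem m i)
    (hv : (v, ct v) ∈ s4CutSystem m i) (hw : (w, ct w) ∈ s4CutSystem m i) : D j v w = 0 := by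
  classical
  -- the erasing projection of slot `i`; no hidden depth for `N i`
  obtain ⟨cti, πi, hcti, hπis, hπiker, -⟩ := helper_glueErasePi m i (stub_cutNormalForm m i)
  have hnhd : πi.ker ⊓ ((⊤ : Subgroup (SurfaceGroup (3 + 3 * m))).lowerCentralSeries 1) ≤ ⁅πi.ker, (⊤ : Subgroup (SurfaceGroup (3 + 3 * m)))⁆ :=
    stub_noHiddenDepth (3 + 3 * m) (3 + 3 * m) πi.ker (isFreeOfRank_quotient_ker πi hπis)
  -- the correction at `x_j` lies in `[N i, S]`
  have hxN : (PresentedGroup.of (j, ct j) : (SurfaceGroup (3 + 3 * m))) ∈ s4Kernels.stabilizeIter m i := by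
    rw [stub_cutNormalForm m i]; exact subset_normalClosure ⟨(j, ct j), hj, rfl⟩
  have hu1 : ψ (PresentedGroup.of (j, ct j)) * (PresentedGroup.of (j, ct j) : (SurfaceGroup (3 + 3 * m)))⁻¹ ∈ s4Kernels.stabilizeIter m i :=
    mul_mem (by rw [← hψi]; exact ⟨_, hxN, rfl⟩) (inv_mem hxN)
  have hu2 : ψ (PresentedGroup.of (j, ct j)) * (PresentedGroup.of (j, ct j) : (SurfaceGroup (3 + 3 * m)))⁻¹ ∈ ⁅πi.ker, (⊤ : Subgroup (SurfaceGroup (3 + 3 * m)))⁆ := by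
    refine hnhd (mem_inf.2 ⟨?_, hψ _⟩)
    rw [hπiker]; exact hu1
  -- the killing endomorphism `ρ` of `F`
  set ρ : (FreeGroup (Fin (3 + 3 * m))) →* (FreeGroup (Fin (3 + 3 * m))) := FreeGroup.lift fun h => if (h, ct h) ∈ s4CutSystem m i then (FreeGroup.of h : (FreeGroup (Fin (3 + 3 * m)))) else 1
    with hρ
  have hρof : ∀ h, ρ (FreeGroup.of h) = if (h, ct h) ∈ s4CutSystem m i then (FreeGroup.of h : (FreeGroup (Fin (3 + 3 * m)))) else 1 :=
    fun h => by rw [hρ, FreeGroup.lift_apply_of]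
  have hker : (s4Kernels.stabilizeIter m i).map π ≤ ρ.ker := by
    rw [stub_cutNormalForm m i, Subgroup.map_normalClosure _ _ hπs]
    refine normalClosure_le_normal ?_
    rintro _ ⟨_, ⟨⟨h, c⟩, hhc, rfl⟩, rfl⟩
    rw [SetLike.mem_coe, MonoidHom.mem_ker, hπof]
    by_cases hc : c = ct h
    · rw [if_pos hc, map_one]
    · rw [if_neg hc, hρof, if_neg]
      intro hmem
      exact hc (((hcti h c).1 hhc).trans ((hcti h (ct h)).1 hmem).symm)
  have hu3 : ρ (π (ψ (PresentedGroup.of (j, ct j)) * (PresentedGroup.of (j, ct j) : (SurfaceGroup (3 + 3 * m)))⁻¹)) = 1 := by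
    have h1 : π (ψ (PresentedGroup.of (j, ct j)) * (PresentedGroup.of (j, ct j) : (SurfaceGroup (3 + 3 * m)))⁻¹) ∈
        (⁅πi.ker, (⊤ : Subgroup (SurfaceGroup (3 + 3 * m)))⁆).map π := ⟨_, hu2, rfl⟩
    rw [map_commutator, hπiker] at h1
    have h2 : ⁅(s4Kernels.stabilizeIter m i).map π, (⊤ : Subgroup (SurfaceGroup (3 + 3 * m))).map π⁆ ≤ ρ.ker :=
      (commutator_mono hker le_top).trans (commutator_le_left ρ.ker ⊤)
    rw [← MonoidHom.mem_ker]
    exact h2 h1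
  -- push the reading through `ρ`
  have h4 : ρ (((List.finRange (3 + 3 * m)).map (fun v => ((List.finRange (3 + 3 * m)).map (fun w => if v < w then ⁅(FreeGroup.of v : FreeGroup (Fin (3 + 3 * m))), FreeGroup.of w⁆ ^ ((if ct j then (-1 : ℤ) else 1) * D j v w) else (1 : (FreeGroup (Fin (3 + 3 * m)))))).prod)).prod) ∈ ((⊤ : Subgroup (FreeGroup (Fin (3 + 3 * m)))).lowerCentralSeries 2) := by
    have h := map_lcs_mem ρ (hD j)
    rw [map_mul, map_inv, hu3, one_mul] at h
    exact (inv_mem_iff).1 h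
  have hpp : ρ (((List.finRange (3 + 3 * m)).map (fun v => ((List.finRange (3 + 3 * m)).map (fun w => if v < w then ⁅(FreeGroup.of v : FreeGroup (Fin (3 + 3 * m))), FreeGroup.of w⁆ ^ ((if ct j then (-1 : ℤ) else 1) * D j v w) else (1 : (FreeGroup (Fin (3 + 3 * m)))))).prod)).prod) =
      (((List.finRange (3 + 3 * m)).map (fun v => ((List.finRange (3 + 3 * m)).map (fun w => if v < w then ⁅(if (fun h => (h, ct h) ∈ s4CutSystem m i) v then (FreeGroup.of v : (FreeGroup (Fin (3 + 3 * m)))) else 1), (if (fun h => (h, ct h) ∈ s4CutSystem m i) w then (FreeGroup.of w : (FreeGroup (Fin (3 + 3 * m)))) else 1)⁆ ^ ((if ct j then (-1 : ℤ) else 1) * D j v w) else (1 : (FreeGroup (Fin (3 + 3 * m)))))).prod)).prod) := by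
    rw [pp_map]
    exact pp_congr _ _ _ _ fun v w _ => by rw [map_commutatorElement, hρof, hρof]
  have hpp' := hpp.trans (pp_kill _ _)
  rw [hpp'] at h4
  have h6 := stub_magnusWittRead.1 (3 + 3 * m) _ h4 v w hvw
  have h7 : (if ct j then (-1 : ℤ) else 1) * D j v w = 0 := by
    have hv' : (fun h : Fin (3 + 3 * m) => (h, ct h) ∈ s4CutSystem m i) v := hv
    have hw' : (fun h : Fin (3 + 3 * m) => (h, ct h) ∈ s4CutSystem m i) w := hw
    rwa [if_pos ⟨hv', hw'⟩] at h6
  rcases Bool.eq_false_or_eq_true (ct j) with hcj | hcj <;>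
    simp only [hcj, Bool.false_eq_true, ↓reduceIte] at h7 <;> omega

end Vanishing

/-! ## §3 Uniqueness of readings -/

section Uniqueness

variable {ct : Fin (3 + 3 * m) → Bool} {π : (SurfaceGroup (3 + 3 * m)) →* (FreeGroup (Fin (3 + 3 * m)))}

/-- **Equal level-two shadows give equal readings on `v < w`** (converse of `map_sup_eq_of_forms_g`): if the
IA-automorphisms `ψ`, `φ` have `ψ(N₂) = φ(N₂)` and read as `D`, `D'`, then `D j v w = D' j v w` for `v < w`. [folklore] -/
theorem forms_eq_of_map_eq (hπs : Function.Surjective π) (hπker : π.ker = s4Kernels.stabilizeIter m 2)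
    (hπof : ∀ (h : Fin (3 + 3 * m)) (c : Bool), π (PresentedGroup.of (h, c)) = if c = ct h then 1 else FreeGroup.of h)
    (ψ φ : (SurfaceGroup (3 + 3 * m)) ≃* (SurfaceGroup (3 + 3 * m))) (hψ : ∀ s : (SurfaceGroup (3 + 3 * m)), ψ s * s⁻¹ ∈ ((⊤ : Subgroup (SurfaceGroup (3 + 3 * m))).lowerCentralSeries 1)) (hφ : ∀ s : (SurfaceGroup (3 + 3 * m)), φ s * s⁻¹ ∈ ((⊤ : Subgroup (SurfaceGroup (3 + 3 * m))).lowerCentralSeries 1))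
    (D D' : Fin (3 + 3 * m) → Fin (3 + 3 * m) → Fin (3 + 3 * m) → ℤ)
    (hD : (∀ j : Fin (3 + 3 * m), π (ψ (PresentedGroup.of (j, ct j)) * (PresentedGroup.of (j, ct j))⁻¹) *
        (((List.finRange (3 + 3 * m)).map (fun v => ((List.finRange (3 + 3 * m)).map (fun w => if v < w then ⁅(FreeGroup.of v : FreeGroup (Fin (3 + 3 * m))), FreeGroup.of w⁆ ^ ((if ct j then (-1 : ℤ) else 1) * D j v w) else (1 : (FreeGroup (Fin (3 + 3 * m)))))).prod)).prod)⁻¹ ∈ ((⊤ : Subgroup (FreeGroup (Fin (3 + 3 * m)))).lowerCentralSeries 2)))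
    (hD' : (∀ j : Fin (3 + 3 * m), π (φ (PresentedGroup.of (j, ct j)) * (PresentedGroup.of (j, ct j))⁻¹) *
        (((List.finRange (3 + 3 * m)).map (fun v => ((List.finRange (3 + 3 * m)).map (fun w => if v < w then ⁅(FreeGroup.of v : FreeGroup (Fin (3 + 3 * m))), FreeGroup.of w⁆ ^ ((if ct j then (-1 : ℤ) else 1) * D' j v w) else (1 : (FreeGroup (Fin (3 + 3 * m)))))).prod)).prod)⁻¹ ∈ ((⊤ : Subgroup (FreeGroup (Fin (3 + 3 * m)))).lowerCentralSeries 2)))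
    (h : (s4Kernels.stabilizeIter m 2).map ψ.toMonoidHom = (s4Kernels.stabilizeIter m 2).map φ.toMonoidHom) :
    ∀ j v w : Fin (3 + 3 * m), v < w → D j v w = D' j v w := by
  intro j v w hvw
  haveI hPn : (s4Kernels.stabilizeIter m 2).Normal := by rw [← hπker]; infer_instance
  haveI hQn : ((s4Kernels.stabilizeIter m 2).map φ.toMonoidHom).Normal := Subgroup.Normal.map hPn _ φ.surjective
  have hQfree : IsFreeOfRank ((SurfaceGroup (3 + 3 * m)) ⧸ (s4Kernels.stabilizeIter m 2).map φ.toMonoidHom) (3 + 3 * m) :=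
    (isFreeOfRank_quotient_ker (π.comp φ.symm.toMonoidHom) (hπs.comp φ.symm.surjective)).of_mulEquiv
      (QuotientGroup.quotientMulEquivOfEq (ker_comp_symm_g hπker φ))
  have hQnhd := stub_noHiddenDepth (3 + 3 * m) (3 + 3 * m) ((s4Kernels.stabilizeIter m 2).map φ.toMonoidHom) hQfree
  have hQP : (s4Kernels.stabilizeIter m 2).map φ.toMonoidHom ⊔ ((⊤ : Subgroup (SurfaceGroup (3 + 3 * m))).lowerCentralSeries 1) = s4Kernels.stabilizeIter m 2 ⊔ ((⊤ : Subgroup (SurfaceGroup (3 + 3 * m))).lowerCentralSeries 1) :=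
    map_sup_lcs_one_of_ia_g φ hφ _
  have hxN : (PresentedGroup.of (j, ct j) : (SurfaceGroup (3 + 3 * m))) ∈ s4Kernels.stabilizeIter m 2 := by
    rw [← hπker, MonoidHom.mem_ker, hπof, if_pos rfl]
  have hy : ψ (PresentedGroup.of (j, ct j)) ∈ (s4Kernels.stabilizeIter m 2).map φ.toMonoidHom ⊔ ((⊤ : Subgroup (SurfaceGroup (3 + 3 * m))).lowerCentralSeries 2) :=
    mem_sup_left (by rw [← h]; exact ⟨_, hxN, rfl⟩)
  have key := (level_mem_iff 0 ((s4Kernels.stabilizeIter m 2).map φ.toMonoidHom) (s4Kernels.stabilizeIter m 2) hQnhd hQP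
    (u := φ (PresentedGroup.of (j, ct j)) * (PresentedGroup.of (j, ct j) : (SurfaceGroup (3 + 3 * m)))⁻¹)
    (x := (PresentedGroup.of (j, ct j) : (SurfaceGroup (3 + 3 * m)))) (y := ψ (PresentedGroup.of (j, ct j)))
    (by rw [inv_mul_cancel_right]; exact ⟨_, hxN, rfl⟩) (hψ _) (hφ _)).1 hy
  -- push through `π`: `[N₂, S]` dies, `γ₃` is preserved
  have hπN : (s4Kernels.stabilizeIter m 2).map π = ⊥ := by
    rw [← hπker, Subgroup.map_eq_bot_iff]
  have h3 : π (ψ (PresentedGroup.of (j, ct j)) * (PresentedGroup.of (j, ct j) : (SurfaceGroup (3 + 3 * m)))⁻¹) *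
      (π (φ (PresentedGroup.of (j, ct j)) * (PresentedGroup.of (j, ct j) : (SurfaceGroup (3 + 3 * m)))⁻¹))⁻¹ ∈ ((⊤ : Subgroup (FreeGroup (Fin (3 + 3 * m)))).lowerCentralSeries 2) := by
    obtain ⟨p, hp, z, hz, heq⟩ := mem_sup_of_normal_right.1 key
    have hp1 : π p = 1 := by
      have h1 : π p ∈ (⁅s4Kernels.stabilizeIter m 2, (⊤ : Subgroup (SurfaceGroup (3 + 3 * m)))⁆).map π := ⟨p, hp, rfl⟩
      rwa [map_commutator, hπN, commutator_bot_left, mem_bot] at h1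
    rw [← map_inv, ← map_mul, ← heq, map_mul, hp1, one_mul]
    exact map_lcs_mem π hz
  -- compare in `F / γ₃ F`, where the basic commutators are central
  have hcen : ∀ v w : Fin (3 + 3 * m), (QuotientGroup.mk' ((⊤ : Subgroup (FreeGroup (Fin (3 + 3 * m)))).lowerCentralSeries 2)) ⁅(FreeGroup.of v : (FreeGroup (Fin (3 + 3 * m)))), FreeGroup.of w⁆ ∈
      center ((FreeGroup (Fin (3 + 3 * m))) ⧸ ((⊤ : Subgroup (FreeGroup (Fin (3 + 3 * m)))).lowerCentralSeries 2)) := fun v w => by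
    rw [map_commutatorElement]; exact quot_commutator_mem_center _ _
  have e1 := (mul_inv_mem_iff_quot _ _ _).1 (hD j)
  have e2 := (mul_inv_mem_iff_quot _ _ _).1 (hD' j)
  have e3 := (mul_inv_mem_iff_quot _ _ _).1 h3
  have step1 : (QuotientGroup.mk' ((⊤ : Subgroup (FreeGroup (Fin (3 + 3 * m)))).lowerCentralSeries 2)) (((List.finRange (3 + 3 * m)).map (fun v => ((List.finRange (3 + 3 * m)).map (fun w => if v < w then ⁅(FreeGroup.of v : FreeGroup (Fin (3 + 3 * m))), FreeGroup.of w⁆ ^ ((if ct j then (-1 : ℤ) else 1) * D j v w) else (1 : (FreeGroup (Fin (3 + 3 * m)))))).prod)).prod) = (QuotientGroup.mk' ((⊤ : Subgroup (FreeGroup (Fin (3 + 3 * m)))).lowerCentralSeries 2)) (((List.finRange (3 + 3 * m)).map (fun v => ((List.finRange (3 + 3 * m)).map (fun w => if v < w then ⁅(FreeGroup.of v : FreeGroup (Fin (3 + 3 * m))), FreeGroup.of w⁆ ^ ((if ct j then (-1 : ℤ) else 1) * D' j v w) else (1 : (FreeGroup (Fin (3 + 3 * m)))))).prod)).prod) :=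 by
    rw [QuotientGroup.mk'_apply, QuotientGroup.mk'_apply, ← e1, e3, e2]
  have step2 : (((List.finRange (3 + 3 * m)).map (fun v => ((List.finRange (3 + 3 * m)).map (fun w => if v < w then ((QuotientGroup.mk' ((⊤ : Subgroup (FreeGroup (Fin (3 + 3 * m)))).lowerCentralSeries 2)) ⁅(FreeGroup.of v : FreeGroup (Fin (3 + 3 * m))), FreeGroup.of w⁆) ^ ((if ct j then (-1 : ℤ) else 1) * D j v w) else (1 : ((FreeGroup (Fin (3 + 3 * m))) ⧸ ((⊤ : Subgroup (FreeGroup (Fin (3 + 3 * m)))).lowerCentralSeries 2))))).prod)).prod) = (((List.finRange (3 + 3 * m)).map (fun v => ((List.finRange (3 + 3 * m)).map (fun w => if v < w then ((QuotientGroup.mk' ((⊤ : Subgroup (FreeGroup (Fin (3 + 3 * m)))).lowerCentralSeries 2)) ⁅(FreeGroup.of v : FreeGroup (Fin (3 + 3 * m))), FreeGroup.of w⁆) ^ ((if ct j then (-1 : ℤ) else 1) * D' j v w) else (1 : ((FreeGroup (Fin (3 + 3 * m))) ⧸ ((⊤ : Subgroup (FreeGroup (Fin (3 + 3 * m)))).lowerCentralSeries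 2))))).prod)).prod) := by
    have h := step1
    rw [pp_map, pp_map] at h
    exact h
  have step3 : (((List.finRange (3 + 3 * m)).map (fun v => ((List.finRange (3 + 3 * m)).map (fun w => if v < w then ((QuotientGroup.mk' ((⊤ : Subgroup (FreeGroup (Fin (3 + 3 * m)))).lowerCentralSeries 2)) ⁅(FreeGroup.of v : FreeGroup (Fin (3 + 3 * m))), FreeGroup.of w⁆) ^ ((if ct j then (-1 : ℤ) else 1) * D j v w) else (1 : ((FreeGroup (Fin (3 + 3 * m))) ⧸ ((⊤ : Subgroup (FreeGroup (Fin (3 + 3 * m)))).lowerCentralSeries 2))))).prod)).prod) = (((List.finRange (3 + 3 * m)).map (fun v => ((List.finRange (3 + 3 * m)).map (fun w => if v < w then ((QuotientGroup.mk' ((⊤ : Subgroup (FreeGroup (Fin (3 + 3 * m)))).lowerCentralSeries 2)) ⁅(FreeGroup.of v : FreeGroup (Fin (3 + 3 * m))), FreeGroup.of w⁆) ^ ((if ct j then (-1 : ℤ) else 1) * D' j v w) else (1 : ((FreeGroup (Fin (3 + 3 * m))) ⧸ ((⊤ : Subgroup (FreeGroup (Fin (3 + 3 * m)))).lowerCentralSeries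 2))))).prod)).prod) *
      (((List.finRange (3 + 3 * m)).map (fun v => ((List.finRange (3 + 3 * m)).map (fun w => if v < w then ((QuotientGroup.mk' ((⊤ : Subgroup (FreeGroup (Fin (3 + 3 * m)))).lowerCentralSeries 2)) ⁅(FreeGroup.of v : FreeGroup (Fin (3 + 3 * m))), FreeGroup.of w⁆) ^ ((if ct j then (-1 : ℤ) else 1) * D j v w - (if ct j then (-1 : ℤ) else 1) * D' j v w) else (1 : ((FreeGroup (Fin (3 + 3 * m))) ⧸ ((⊤ : Subgroup (FreeGroup (Fin (3 + 3 * m)))).lowerCentralSeries 2))))).prod)).prod) := by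
    rw [← pp_add (fun v w => ((QuotientGroup.mk' ((⊤ : Subgroup (FreeGroup (Fin (3 + 3 * m)))).lowerCentralSeries 2)) ⁅(FreeGroup.of v : FreeGroup (Fin (3 + 3 * m))), FreeGroup.of w⁆)) hcen]
    exact pp_congr _ _ _ _ fun v w _ => by rw [add_sub_cancel]
  rw [step2] at step3
  have step4 := mul_eq_left.1 step3.symm
  have step5 : (QuotientGroup.mk' ((⊤ : Subgroup (FreeGroup (Fin (3 + 3 * m)))).lowerCentralSeries 2)) (((List.finRange (3 + 3 * m)).map (fun v => ((List.finRange (3 + 3 * m)).map (fun w => if v < w then ⁅(FreeGroup.of v : FreeGroup (Fin (3 + 3 * m))), FreeGroup.of w⁆ ^ ((if ct j then (-1 : ℤ) else 1) * D j v w - (if ct j then (-1 : ℤ) else 1) * D' j v w) else (1 : (FreeGroup (Fin (3 + 3 * m)))))).prod)).prod) = 1 := by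
    rw [pp_map]; exact step4
  rw [QuotientGroup.mk'_apply, QuotientGroup.eq_one_iff] at step5
  have h6 := stub_magnusWittRead.1 (3 + 3 * m) _ step5 v w hvw
  rcases Bool.eq_false_or_eq_true (ct j) with hcj | hcj <;>
    simp only [hcj, Bool.false_eq_true, ↓reduceIte] at h6 <;> omega

end Uniqueness

/-! ## Registered helper -/

/-- **Registered helper `helper_pairNormalisationSlot`** (sub-goal of stub `stub_layerStepTwoZero`, crux
stmt-SmoothPoincare4-14595): pair normalisation keeping the slot, in closed form — given (AUTSYMP) at genus `3+3m` and a
slot `i ≠ 2`, an `α ∈ Stab Nᵢ` with `α(N₂) = P`, `P γ₂ = N₂ γ₂` is replaced by an IA-automorphism in `Stab Nᵢ` carrying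
`N₂` onto `P`. [folklore] -/
theorem helper_pairNormalisationSlot : ∀ (m : ℕ), (∀ (φ : SurfaceGroup (3 + 3 * m) ≃* SurfaceGroup (3 + 3 * m)), ∃ (F : (surfaceGen (3 + 3 * m) → ℤ) ≃ₗ[ℤ] (surfaceGen (3 + 3 * m) → ℤ)) (ε : ℤ), (ε = 1 ∨ ε = -1) ∧ (∀ s : SurfaceGroup (3 + 3 * m), toAdd (SurfaceGroup.abelianize (3 + 3 * m) (φ s)) = F (toAdd (SurfaceGroup.abelianize (3 + 3 * m) s))) ∧ ∀ u v : surfaceGen (3 + 3 * m) → ℤ, symplForm (F u) (F v) = ε * symplForm u v) → ∀ (i : Fin 3), i ≠ 2 → ∀ (P : Subgroup (SurfaceGroup (3 + 3 * m))) (α : SurfaceGroup (3 + 3 * m) ≃* SurfaceGroup (3 + 3 * m)), (s4Kernels.stabilizeIter m i).map α.toMonoidHom = s4Kernels.stabilizeIter m i → (s4Kernels.stabilizeIter m 2).map α.toMonoidHom = P → P ⊔ (⊤ : Subgroup (SurfaceGroup (3 + 3 * m))).lowerCentralSeries 1 = s4Kernels.stabilizeIter m 2 ⊔ (⊤ : Subgroup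 (SurfaceGroup (3 + 3 * m))).lowerCentralSeries 1 → ∃ α' : SurfaceGroup (3 + 3 * m) ≃* SurfaceGroup (3 + 3 * m), (∀ s : SurfaceGroup (3 + 3 * m), α' s * s⁻¹ ∈ (⊤ : Subgroup (SurfaceGroup (3 + 3 * m))).lowerCentralSeries 1) ∧ (s4Kernels.stabilizeIter m i).map α'.toMonoidHom = s4Kernels.stabilizeIter m i ∧ (s4Kernels.stabilizeIter m 2).map α'.toMonoidHom = P :=
  fun _ hA _ hi _ _ hαi hα2 hP => exists_ia_stab_of_pair_stabilizeIter hA hi hαi hα2 hP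

end Summit.SmoothPoincare4.SmoothPoincare4.Theorems.ShadowApproximation.NilpotentGenusClass

end
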